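import Mathlib
import Literature.AlgebraicGeometry.Resolution.AffineBlowupRegular
import Summits.ResolutionOfSingularities.ResolutionOfSingularities.Theorems.WildQuotientsWildQuotientResolutionJordanFourChartTMembers
import HarnessLib

/-!
# Programme V4U: `I₆`-facts for an ABSTRACT generator vector `g : Fin 8 → k[x]` (memberships, Rees identities, vertex cover)

(crux stmt-ResolutionOfSingularities-15640 `WildQuotients.WildQuotientResolution`, line `Sketch`,
sector `|G| = p`; programme V4U of `L/w45c/CHAIN.md` v6 §4 row stub-2 (T2 support); [OURS · L1 W4.5c]
— NOT a statement of any manuscript; replaces the role of no printed item.)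

ENGINEERING NOTE. The vector of record `![X a ^ 2, X a * X b ^ 2, X a * X b * X c, X a * X c ^ 3, X b ^ 3,
X b ^ 2 * X c ^ 2, X b * X c ^ 4, X c ^ 6]` makes arithmetic in the Rees algebra `k[x][I₆t]` prohibitively
slow to elaborate (each defeq check re-normalises the `Fin 8` vector literal). The files of package T2
(the twisted root chart `W_T`) are therefore stated for a VARIABLE `g : Fin 8 → k[x]` with the eight
pointwise hypotheses `g 0 = X a ^ 2, …, g 7 = X c ^ 6`; consumers instantiate `g` with the vector of
record and each hypothesis with `rfl`. This file: the memberships of `…JordanFourChartTMembers` in this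
form (`T', H'², x_aH', MH', x_aM, M² ∈ (g)`, `H'³, Δ₇ ∈ (g)²`), the Rees identities
`(g₂t)⁶ = (g₀t)³(g₄t)²(g₇t)`, `(g₁t)³ = x_a(g₀t)(g₄t)²`, `(g₃t)² = (g₀t)(g₇t)`, `(g₅t)³ = (g₄t)²(g₇t)`,
`(g₆t)³ = (g₄t)(g₇t)²`, and the vertex-chart cover `D₊(g₀t) ∪ D₊(g₄t) ∪ D₊(g₇t) = Bl_{(g)} 𝔸ⁿ` (the
abstract form of p490172/p489593).
-/

-- single-problem summit: the doubled namespace component `ResolutionOfSingularities` is forced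
set_option linter.dupNamespace false

noncomputable section

open MvPolynomial Polynomial AlgebraicGeometry TopologicalSpace HomogeneousLocalization
open Literature.AlgebraicGeometry.Resolution

namespace Summit.ResolutionOfSingularities.ResolutionOfSingularities.Theorems.WildQuotientResolution.JordanFour

variable (k : Type) [Field k] (n : ℕ) (a b c d : Fin n) (g : Fin 8 → MvPolynomial (Fin n) k)
  (hg0 : g 0 = X a ^ 2) (hg1 : g 1 = X a * X b ^ 2) (hg2 : g 2 = X a * X b * X c) (hg3 : g 3 = X a * X c ^ 3)
  (hg4 : g 4 = X b ^ 3) (hg5 : g 5 = X b ^ 2 * X c ^ 2) (hg6 : g 6 = X b * X c ^ 4) (hg7 : g 7 = X c ^ 6)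

local notation3 "Ig" => Ideal.span (Set.range g)
local notation3 "Tp" => (X b ^ 3 - 3 * X a * X b * X c + 3 * X a ^ 2 * X d - X a ^ 2 * X b :
  MvPolynomial (Fin n) k)
local notation3 "Hp" => (X b ^ 2 - X a * X b - 2 * X a * X c : MvPolynomial (Fin n) k)
local notation3 "Mp" => (X b * X c - X b ^ 2 + X a * X b - 3 * X a * X d : MvPolynomial (Fin n) k)
/-- the Rees generator `g_j t` -/
local notation3 (prettyPrint := false) "gT" j =>
  reesT (I := Ig) (g j) (Ideal.mem_span_range_self (f := g) (x := j))

/-! ### Memberships in `(g)` and `(g)²` -/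

include hg0 hg1 hg2 hg3 hg4 hg5 hg6 hg7 in
/-- A combination `Σ c_j g_j` lies in `(g)`. [folklore] -/
theorem sum_mul_mem_span (c₀ c₁ c₂ c₃ c₄ c₅ c₆ c₇ : MvPolynomial (Fin n) k) :
    c₀ * (X a ^ 2) + c₁ * (X a * X b ^ 2) + c₂ * (X a * X b * X c) + c₃ * (X a * X c ^ 3) +
      c₄ * (X b ^ 3) + c₅ * (X b ^ 2 * X c ^ 2) + c₆ * (X b * X c ^ 4) + c₇ * (X c ^ 6) ∈ Ig := by
  have h : ∀ j, g j ∈ Ig := fun j => Ideal.subset_span ⟨j, rfl⟩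
  rw [← hg0, ← hg1, ← hg2, ← hg3, ← hg4, ← hg5, ← hg6, ← hg7]
  exact Ideal.add_mem _ (Ideal.add_mem _ (Ideal.add_mem _ (Ideal.add_mem _ (Ideal.add_mem _ (Ideal.add_mem _
    (Ideal.add_mem _ (Ideal.mul_mem_left _ _ (h 0)) (Ideal.mul_mem_left _ _ (h 1))) (Ideal.mul_mem_left _ _ (h 2)))
    (Ideal.mul_mem_left _ _ (h 3))) (Ideal.mul_mem_left _ _ (h 4))) (Ideal.mul_mem_left _ _ (h 5)))
    (Ideal.mul_mem_left _ _ (h 6))) (Ideal.mul_mem_left _ _ (h 7))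

include hg0 hg1 hg2 hg3 hg4 hg5 hg6 in
/-- A combination `Σ c_{jk} g_j g_k` (the products occurring in the cofactor tables) lies in `(g)²`.
[folklore] -/
theorem sum_mul_mem_span_sq (c₀₀ c₀₁ c₀₂ c₀₃ c₀₄ c₀₅ c₀₆ c₁₄ c₁₅ c₂₄ c₂₅ c₄₄ c₄₅ : MvPolynomial (Fin n) k) :
    c₀₀ * (X a ^ 2 * X a ^ 2) + c₀₁ * (X a ^ 2 * (X a * X b ^ 2)) + c₀₂ * (X a ^ 2 * (X a * X b * X c)) +
      c₀₃ * (X a ^ 2 * (X a * X c ^ 3)) + c₀₄ * (X a ^ 2 * X b ^ 3) + c₀₅ * (X a ^ 2 * (X b ^ 2 * X c ^ 2)) +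
      c₀₆ * (X a ^ 2 * (X b * X c ^ 4)) + c₁₄ * (X a * X b ^ 2 * X b ^ 3) +
      c₁₅ * (X a * X b ^ 2 * (X b ^ 2 * X c ^ 2)) + c₂₄ * (X a * X b * X c * X b ^ 3) +
      c₂₅ * (X a * X b * X c * (X b ^ 2 * X c ^ 2)) + c₄₄ * (X b ^ 3 * X b ^ 3) +
      c₄₅ * (X b ^ 3 * (X b ^ 2 * X c ^ 2)) ∈ Ig ^ 2 := by
  have h : ∀ j, g j ∈ Ig := fun j => Ideal.subset_span ⟨j, rfl⟩
  have m : ∀ (w : MvPolynomial (Fin n) k) (j l : Fin 8), w * (g j * g l) ∈ Ig ^ 2 := fun w j l => by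
    rw [pow_two]; exact Ideal.mul_mem_left _ _ (Ideal.mul_mem_mul (h j) (h l))
  rw [← hg0, ← hg1, ← hg2, ← hg3, ← hg4, ← hg5, ← hg6]
  exact Ideal.add_mem _ (Ideal.add_mem _ (Ideal.add_mem _ (Ideal.add_mem _ (Ideal.add_mem _ (Ideal.add_mem _
    (Ideal.add_mem _ (Ideal.add_mem _ (Ideal.add_mem _ (Ideal.add_mem _ (Ideal.add_mem _ (Ideal.add_mem _
    (m _ 0 0) (m _ 0 1)) (m _ 0 2)) (m _ 0 3)) (m _ 0 4)) (m _ 0 5)) (m _ 0 6)) (m _ 1 4)) (m _ 1 5)) (m _ 2 4))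
    (m _ 2 5)) (m _ 4 4)) (m _ 4 5)

include hg0 hg1 hg2 hg3 hg4 hg5 hg6 hg7 in
/-- `T' ∈ (g)`. [folklore] -/
theorem Tprime_mem_span : Tp ∈ Ig := by
  rw [tprime_eq_cofactors]; exact sum_mul_mem_span k n a b c g hg0 hg1 hg2 hg3 hg4 hg5 hg6 hg7 _ _ _ _ _ _ _ _

include hg0 hg1 hg2 hg3 hg4 hg5 hg6 hg7 in
/-- `H'² ∈ (g)`. [folklore] -/
theorem Hsq_mem_span : Hp ^ 2 ∈ Ig := by
  rw [hsq_eq_cofactors]; exact sum_mul_mem_span k n a b c g hg0 hg1 hg2 hg3 hg4 hg5 hg6 hg7 _ _ _ _ _ _ _ _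

include hg0 hg1 hg2 hg3 hg4 hg5 hg6 hg7 in
/-- `x_a H' ∈ (g)`. [folklore] -/
theorem xaH_mem_span : X a * Hp ∈ Ig := by
  rw [xaH_eq_cofactors]; exact sum_mul_mem_span k n a b c g hg0 hg1 hg2 hg3 hg4 hg5 hg6 hg7 _ _ _ _ _ _ _ _

include hg0 hg1 hg2 hg3 hg4 hg5 hg6 hg7 in
/-- `M H' ∈ (g)`. [folklore] -/
theorem MH_mem_span : Mp * Hp ∈ Ig := by
  rw [mH_eq_cofactors]; exact sum_mul_mem_span k n a b c g hg0 hg1 hg2 hg3 hg4 hg5 hg6 hg7 _ _ _ _ _ _ _ _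

include hg0 hg1 hg2 hg3 hg4 hg5 hg6 hg7 in
/-- `x_a M ∈ (g)`. [folklore] -/
theorem xaM_mem_span : X a * Mp ∈ Ig := by
  rw [xaM_eq_cofactors]; exact sum_mul_mem_span k n a b c g hg0 hg1 hg2 hg3 hg4 hg5 hg6 hg7 _ _ _ _ _ _ _ _

include hg0 hg1 hg2 hg3 hg4 hg5 hg6 hg7 in
/-- `M² ∈ (g)`. [folklore] -/
theorem Msq_mem_span : Mp ^ 2 ∈ Ig := by
  rw [msq_eq_cofactors]; exact sum_mul_mem_span k n a b c g hg0 hg1 hg2 hg3 hg4 hg5 hg6 hg7 _ _ _ _ _ _ _ _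

include hg0 in
/-- `x_a² = g₀ ∈ (g)`. [folklore] -/
theorem Xa_sq_mem_span : (X a ^ 2 : MvPolynomial (Fin n) k) ∈ Ig :=
  hg0 ▸ Ideal.subset_span ⟨0, rfl⟩

include hg0 hg1 hg2 hg3 hg4 hg5 hg6 in
/-- `H'³ ∈ (g)²`. [folklore] -/
theorem Hcube_mem_span_sq : Hp ^ 3 ∈ Ig ^ 2 := by
  rw [hcube_eq_cofactors]
  exact sum_mul_mem_span_sq k n a b c g hg0 hg1 hg2 hg3 hg4 hg5 hg6 _ _ _ _ _ _ _ _ _ _ _ _ _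

include hg0 hg1 hg2 hg3 hg4 hg5 hg6 in
/-- **`Δ₇ ∈ (g)²` with `x_a² Δ₇ = T'H'³ − T'³ + 3x_aT'²H'`.** [folklore] -/
theorem exists_Delta7_mem_span_sq : ∃ Δ ∈ Ig ^ 2,
    X a ^ 2 * Δ = Tp * Hp ^ 3 - Tp ^ 3 + 3 * X a * Tp ^ 2 * Hp :=
  ⟨_, sum_mul_mem_span_sq k n a b c g hg0 hg1 hg2 hg3 hg4 hg5 hg6 _ _ _ _ _ _ _ _ _ _ _ _ _,
    delta7_relation (X a) (X b) (X c) (X d)⟩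

/-! ### Rees identities among the generator charts -/

include hg0 hg2 hg4 hg7 in
/-- `(g₂t)⁶ = (g₀t)³ (g₄t)² (g₇t)` (`x_ax_bx_c` is the interior point of the facet). [folklore] -/
theorem reesT_two_pow : (gT 2) ^ 6 = (gT 0) ^ 3 * (gT 4) ^ 2 * (gT 7) := by
  apply Subtype.ext
  simp only [Subalgebra.coe_pow, Subalgebra.coe_mul, coe_reesT, hg0, hg2, hg4, hg7, Polynomial.monomial_pow,
    Polynomial.monomial_mul_monomial]
  exact congrArg _ (by ring)

include hg0 hg1 hg4 in
/-- `(g₁t)³ = x_a · (g₀t)(g₄t)²` (`x_ax_b²` lies above the facet). [folklore] -/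
theorem reesT_one_pow : (gT 1) ^ 3 =
    algebraMap (MvPolynomial (Fin n) k) (reesAlgebra Ig) (X a) * ((gT 0) * (gT 4) ^ 2) := by
  apply Subtype.ext
  simp only [Subalgebra.coe_pow, Subalgebra.coe_mul, Subalgebra.coe_algebraMap, coe_reesT, hg0, hg1, hg4,
    Polynomial.algebraMap_eq, Polynomial.monomial_pow, Polynomial.monomial_mul_monomial,
    Polynomial.C_mul_monomial]
  exact congrArg _ (by ring)

include hg0 hg3 hg7 in
/-- `(g₃t)² = (g₀t)(g₇t)`. [folklore] -/
theorem reesT_three_sq : (gT 3) ^ 2 = (gT 0) * (gT 7) := by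
  apply Subtype.ext
  simp only [Subalgebra.coe_pow, Subalgebra.coe_mul, coe_reesT, hg0, hg3, hg7, Polynomial.monomial_pow,
    Polynomial.monomial_mul_monomial]
  exact congrArg _ (by ring)

include hg4 hg5 hg7 in
/-- `(g₅t)³ = (g₄t)²(g₇t)`. [folklore] -/
theorem reesT_five_cube : (gT 5) ^ 3 = (gT 4) ^ 2 * (gT 7) := by
  apply Subtype.ext
  simp only [Subalgebra.coe_pow, Subalgebra.coe_mul, coe_reesT, hg4, hg5, hg7, Polynomial.monomial_pow,
    Polynomial.monomial_mul_monomial]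
  exact congrArg _ (by ring)

include hg4 hg6 hg7 in
/-- `(g₆t)³ = (g₄t)(g₇t)²`. [folklore] -/
theorem reesT_six_cube : (gT 6) ^ 3 = (gT 4) * (gT 7) ^ 2 := by
  apply Subtype.ext
  simp only [Subalgebra.coe_pow, Subalgebra.coe_mul, coe_reesT, hg4, hg6, hg7, Polynomial.monomial_pow,
    Polynomial.monomial_mul_monomial]
  exact congrArg _ (by ring)

/-! ### The vertex-chart cover -/

include hg0 hg1 hg2 hg3 hg4 hg5 hg6 hg7 in
/-- **`D₊(g₀t) ∪ D₊(g₄t) ∪ D₊(g₇t) = Bl_{(g)} 𝔸ⁿ`** (the three vertex charts cover; the other five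
generator charts lie in vertex charts by the Rees identities). [folklore] -/
theorem vertexCharts_eq_top :
    Proj.basicOpen (reesGrading Ig) (gT 0) ⊔ Proj.basicOpen (reesGrading Ig) (gT 4) ⊔
      Proj.basicOpen (reesGrading Ig) (gT 7) = ⊤ := by
  refine top_le_iff.mp ?_
  rw [← affineBlowup.iSup_basicOpen_reesT_generators_eq_top g]
  refine iSup_le fun i => ?_
  fin_cases i
  · exact le_sup_left.trans le_sup_left
  · -- `D₊(g₁t) ⊆ D₊(g₀t)`
    show Proj.basicOpen (reesGrading Ig) (gT 1) ≤ _
    refine le_trans ?_ (le_sup_left.trans le_sup_left)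
    rw [← Proj.basicOpen_pow _ _ 3 (by norm_num), reesT_one_pow k n a b g hg0 hg1 hg4, Proj.basicOpen_mul,
      Proj.basicOpen_mul]
    exact inf_le_right.trans inf_le_left
  · -- `D₊(g₂t) ⊆ D₊(g₇t)`
    show Proj.basicOpen (reesGrading Ig) (gT 2) ≤ _
    refine le_trans ?_ le_sup_right
    rw [← Proj.basicOpen_pow _ _ 6 (by norm_num), reesT_two_pow k n a b c g hg0 hg2 hg4 hg7, Proj.basicOpen_mul]
    exact inf_le_right
  · -- `D₊(g₃t) ⊆ D₊(g₇t)`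
    show Proj.basicOpen (reesGrading Ig) (gT 3) ≤ _
    refine le_trans ?_ le_sup_right
    rw [← Proj.basicOpen_pow _ _ 2 two_pos, reesT_three_sq k n a c g hg0 hg3 hg7, Proj.basicOpen_mul]
    exact inf_le_right
  · exact le_sup_right.trans le_sup_left
  · -- `D₊(g₅t) ⊆ D₊(g₇t)`
    show Proj.basicOpen (reesGrading Ig) (gT 5) ≤ _
    refine le_trans ?_ le_sup_right
    rw [← Proj.basicOpen_pow _ _ 3 (by norm_num), reesT_five_cube k n b c g hg4 hg5 hg7, Proj.basicOpen_mul]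
    exact inf_le_right
  · -- `D₊(g₆t) ⊆ D₊(g₇t)`
    show Proj.basicOpen (reesGrading Ig) (gT 6) ≤ _
    refine le_trans ?_ le_sup_right
    rw [← Proj.basicOpen_pow _ _ 3 (by norm_num), reesT_six_cube k n b c g hg4 hg6 hg7, Proj.basicOpen_mul,
      Proj.basicOpen_pow _ _ 2 two_pos]
    exact inf_le_right
  · exact le_sup_right

end Summit.ResolutionOfSingularities.ResolutionOfSingularities.Theorems.WildQuotientResolution.JordanFour

end
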